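import Literature.NumberTheory.PAdicHodge.CyclotomicTilt
import HarnessLib

/-!
# Fontaine's element `ω = Σ_{i<p} [ε^{1/p}]^i` and the factorisation `[ε] − 1 = ([ε^{1/p}] − 1)·ω`

For a nonarchimedean local field `F` of characteristic `0` and residue characteristic `p`, with
`ε = (1, ζ_p, ζ_{p²}, …) ∈ 𝒪_{ℂ_F}♭` (file `CyclotomicTilt`):

* `epsRoot = ε^{1/p} = φ⁻¹(ε)`, with `(ε^{1/p})♯ = ζ_p` (`untilt_epsRoot`);
* `omega = 1 + [ε^{1/p}] + ⋯ + [ε^{1/p}]^{p-1} ∈ 𝔸_inf(F)`, with `θ(ω) = 1 + ζ_p + ⋯ + ζ_p^{p-1} = 0`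
  (inside `exists_omega_eq_xi_mul`) and `u = [ε] − 1 = ([ε^{1/p}] − 1)·ω` (`uAinf_eq_mul_omega`);
* `θ([ε^{1/p}] − 1) = ζ_p − 1 ≠ 0` (`fontaineTheta_teichmuller_epsRoot_sub_one_ne_zero`);
* **`ω = ξ·c` with `θ(c) ≠ 0`** (`exists_omega_eq_xi_mul`): `ω ∉ ξ²𝔸_inf`, by the level-one
  norm computation `‖1 + ζ_{p²} + ⋯ + ζ_{p²}^{p-1}‖^p = ‖p‖ > ‖p‖²` in `ℂ_F`
  (from `‖ζ_{pᵐ} − 1‖^{φ(pᵐ)} = ‖p‖`, file `CyclotomicTower`).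

Consequently `u = ξ·c'` with `θ(c') ≠ 0` (`exists_uAinf_eq_xi_mul`): in `B_dR⁺(F)` the element
`u = [ε] − 1` (and `t = log[ε]`) is a uniformizer (Fontaine 1994, Exp. II §1.5.4–1.5.5;
Fontaine–Ouyang Prop. 5.1.6).

## References
* [FontaineAsterisque223III] J.-M. Fontaine, *Le corps des périodes p-adiques*, Astérisque 223
  (1994), Exp. II, §1.2.2, §1.5.4–1.5.5.
* [FontaineOuyang2022] J.-M. Fontaine, Y. Ouyang, *Theory of p-adic Galois representations*
  (book draft), Prop. 5.1.6.
-/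

noncomputable section

open ValuativeRel Field Ideal WittVector UniformSpace

namespace Literature.NumberTheory.PAdicHodge

open Literature.NumberTheory.GaloisRepresentations
open Literature.NumberTheory.GaloisRepresentations.IsNonarchimedeanLocalField

variable {F : Type} [Field F] [ValuativeRel F] [TopologicalSpace F] [IsNonarchimedeanLocalField F]
  [CharZero F] {p : ℕ} [Fact p.Prime]

/-! ### More on `ζ_{pⁿ}` -/

/-- `epsC p (n + k) ^ pᵏ = epsC p n`. [folklore] -/
theorem epsC_add_pow (n : ℕ) : ∀ k : ℕ, (epsC p (n + k) : integerC F) ^ p ^ k = epsC p n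
  | 0 => by rw [add_zero, pow_zero, pow_one]
  | k + 1 => by rw [← add_assoc, pow_succ', pow_mul, epsC_succ_pow, epsC_add_pow n k]

/-- `‖ζ_{pᵐ} − 1‖ ^ φ(pᵐ) = ‖p‖` in `ℂ_F` for our `ζ_{pᵐ} = epsRaw p m` (`m ≥ 1`). [cite: FontaineOuyang2022, §3.1] -/
theorem norm_epsC_sub_one_pow {m : ℕ} (hm : 1 ≤ m) :
    ‖((epsC p m : integerC F) : CompletedAlgClosure F) - 1‖ ^ (p ^ m).totient = ‖(p : CompletedAlgClosure F)‖ := by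
  rw [show ((epsC p m : integerC F) : CompletedAlgClosure F) = ((epsRaw p m : NormedAlgClosure F) : CompletedAlgClosure F)
      from rfl, ← Completion.coe_one, ← Completion.coe_sub, Completion.norm_coe,
    CyclotomicTower.norm_sub_one_eq_of_isPrimitiveRoot (isPrimitiveRoot_epsRaw m),
    CyclotomicTower.norm_zeta_sub_one_pow hm, ← Completion.norm_coe]
  congr 1
  change (Completion.coeRingHom : NormedAlgClosure F →+* CompletedAlgClosure F) (p : NormedAlgClosure F) = (p : CompletedAlgClosure F)
  exact map_natCast _ _

/-- `ζ_p ≠ 1` in `𝒪_{ℂ_F}`. [folklore] -/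
theorem epsC_one_ne_one : (epsC p 1 : integerC F) ≠ 1 := by
  intro h
  have h1 : (epsRaw p 1 : NormedAlgClosure F) = 1 := by
    have h2 := congrArg (fun x : integerC F => (x : CompletedAlgClosure F)) h
    simp only [OneMemClass.coe_one] at h2
    exact Completion.coe_injective (NormedAlgClosure F) (by rw [← Completion.coe_one] at h2; exact h2)
  have h3 := isPrimitiveRoot_epsRaw (F := F) (p := p) 1
  rw [h1, pow_one] at h3
  exact absurd (h3.unique IsPrimitiveRoot.one) (Fact.out : p.Prime).one_lt.ne'

/-- `1 + ζ_p + ⋯ + ζ_p^{p-1} = 0` in `𝒪_{ℂ_F}`. [folklore] -/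
theorem geom_sum_epsC_one : (Finset.range p).sum (fun i => (epsC p 1 : integerC F) ^ i) = 0 := by
  have h := (isPrimitiveRoot_epsRaw (F := F) (p := p) 1).geom_sum_eq_zero
    (by rw [pow_one]; exact (Fact.out : p.Prime).one_lt)
  rw [pow_one] at h
  have h2 : (Finset.range p).sum (fun i => (((epsRaw p 1 : NormedAlgClosure F)) : CompletedAlgClosure F) ^ i) = 0 := by
    have h3 := congrArg (Completion.coeRingHom : NormedAlgClosure F →+* CompletedAlgClosure F) h
    rw [map_sum, map_zero] at h3
    simp only [map_pow] at h3
    exact h3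
  refine Subtype.ext ?_
  have h4 := map_sum (integerC F).subtype (fun i => (epsC p 1 : integerC F) ^ i) (Finset.range p)
  rw [Subring.coe_subtype] at h4
  rw [h4]
  simp only [SubmonoidClass.coe_pow, ZeroMemClass.coe_zero]
  exact h2

section Tilt

variable [Fact (¬ IsUnit (p : integerC F))]

/-! ### `ε^{1/p}` -/

/-- **`ε^{1/p} = φ⁻¹(ε) = (ζ_{p^{n+1}} mod p)_n`.** [cite: FontaineOuyang2022, Prop. 5.1.6] -/
def epsRoot : PreTilt (integerC F) p := (frobeniusEquiv (PreTilt (integerC F) p) p).symm eps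

/-- Coefficients of `ε^{1/p}`. [folklore] -/
@[simp] theorem coeff_epsRoot (n : ℕ) :
    PreTilt.coeff n (epsRoot : PreTilt (integerC F) p) = Ideal.Quotient.mk _ (epsC p (n + 1)) := by
  rw [epsRoot, PreTilt.coeff_frobeniusEquiv_symm, coeff_eps]

/-- `(ε^{1/p})^p = ε`. [folklore] -/
theorem epsRoot_pow : (epsRoot : PreTilt (integerC F) p) ^ p = eps := by
  rw [epsRoot, ← frobenius_def, frobenius_apply_frobeniusEquiv_symm]

variable [IsAdicComplete (Ideal.span {(p : integerC F)}) (integerC F)]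

/-- **`(ε^{1/p})♯ = ζ_p`.** [cite: FontaineOuyang2022, Prop. 5.1.6] -/
theorem untilt_epsRoot : PreTilt.untilt (epsRoot : PreTilt (integerC F) p) = epsC p 1 := by
  change Perfection.teichmuller p (Ideal.span {(p : integerC F)}) epsRoot = _
  refine Perfection.teichmuller_spec fun n => ⟨epsC p (n + 1), (coeff_epsRoot n).symm, ?_⟩
  rw [add_comm, epsC_add_pow]
  exact SModEq.refl (M := integerC F) _

/-- `θ([ε^{1/p}]) = ζ_p`. [folklore] -/
theorem fontaineTheta_teichmuller_epsRoot :
    fontaineTheta (integerC F) p (teichmuller p (epsRoot : PreTilt (integerC F) p)) = epsC p 1 := by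
  rw [fontaineTheta_teichmuller, untilt_epsRoot]

/-- **`θ([ε^{1/p}] − 1) = ζ_p − 1 ≠ 0`.** [cite: FontaineOuyang2022, Prop. 5.1.6] -/
theorem fontaineTheta_teichmuller_epsRoot_sub_one_ne_zero :
    fontaineTheta (integerC F) p (teichmuller p (epsRoot : PreTilt (integerC F) p) - 1) ≠ 0 := by
  rw [map_sub, fontaineTheta_teichmuller_epsRoot, map_one, sub_ne_zero]
  exact epsC_one_ne_one

/-! ### `ω` -/

/-- **Fontaine's `ω = 1 + [ε^{1/p}] + ⋯ + [ε^{1/p}]^{p-1} ∈ 𝔸_inf(F)`.** [cite: FontaineAsterisque223III, Exp. II §1.2.2]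
[cite: FontaineOuyang2022, Prop. 5.1.6] -/
def omega : Ainf (p := p) F := (Finset.range p).sum fun i => teichmuller p (epsRoot : PreTilt (integerC F) p) ^ i

omit [IsAdicComplete (Ideal.span {(p : integerC F)}) (integerC F)] in
/-- Unfolding of `ω`. [folklore] -/
theorem omega_def : (omega : Ainf (p := p) F) = (Finset.range p).sum fun i => teichmuller p (epsRoot : PreTilt (integerC F) p) ^ i := rfl

omit [IsAdicComplete (Ideal.span {(p : integerC F)}) (integerC F)] in
/-- **`u = [ε] − 1 = ([ε^{1/p}] − 1)·ω`.** [cite: FontaineOuyang2022, Prop. 5.1.6] -/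
theorem uAinf_eq_mul_omega :
    (uAinf : Ainf (p := p) F) = (teichmuller p (epsRoot : PreTilt (integerC F) p) - 1) * omega := by
  rw [uAinf_def, omega_def, mul_comm, geom_sum_mul, ← map_pow, epsRoot_pow]

omit [IsAdicComplete (Ideal.span {(p : integerC F)}) (integerC F)] in
/-- `ω mod p = 1 + ε^{1/p} + ⋯ + (ε^{1/p})^{p-1}` in `𝒪_{ℂ_F}♭`. [folklore] -/
theorem constantCoeff_omega :
    constantCoeff (omega : Ainf (p := p) F) = (Finset.range p).sum fun i => (epsRoot : PreTilt (integerC F) p) ^ i := by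
  rw [omega_def, map_sum]
  simp only [map_pow, constantCoeff_apply, teichmuller_coeff_zero]

omit [IsAdicComplete (Ideal.span {(p : integerC F)}) (integerC F)] in
/-- The first coefficient of `ω mod p` is `1 + ζ_{p²} + ⋯ + ζ_{p²}^{p-1} mod p`. [folklore] -/
theorem coeff_one_constantCoeff_omega :
    PreTilt.coeff 1 (constantCoeff (omega : Ainf (p := p) F)) =
      Ideal.Quotient.mk _ ((Finset.range p).sum fun i => (epsC p 2 : integerC F) ^ i) := by
  rw [constantCoeff_omega, map_sum, map_sum]
  simp only [map_pow, coeff_epsRoot]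

/-! ### The norm computation at level one -/

omit [Fact (¬ IsUnit (p : integerC F))] [IsAdicComplete (Ideal.span {(p : integerC F)}) (integerC F)] in
/-- **`‖1 + ζ_{p²} + ⋯ + ζ_{p²}^{p-1}‖ ^ p = ‖p‖`** in `ℂ_F`. [cite: FontaineOuyang2022, Prop. 5.1.6] -/
theorem norm_geom_sum_epsC_two_pow :
    ‖(((Finset.range p).sum fun i => (epsC p 2 : integerC F) ^ i : integerC F) : CompletedAlgClosure F)‖ ^ p =
      ‖(p : CompletedAlgClosure F)‖ := by
  have hp := (Fact.out : p.Prime)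
  set S : CompletedAlgClosure F := (((Finset.range p).sum fun i => (epsC p 2 : integerC F) ^ i : integerC F) : CompletedAlgClosure F) with hS
  set z2 : CompletedAlgClosure F := ((epsC p 2 : integerC F) : CompletedAlgClosure F) with hz2
  set z1 : CompletedAlgClosure F := ((epsC p 1 : integerC F) : CompletedAlgClosure F) with hz1
  -- `S (ζ_{p²} − 1) = ζ_p − 1`
  have hgeom : S * (z2 - 1) = z1 - 1 := by
    have h := geom_sum_mul (epsC p 2 : integerC F) p
    rw [show (epsC p 2 : integerC F) ^ p = epsC p 1 from epsC_succ_pow 1] at h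
    have h2 := congrArg (fun x : integerC F => (x : CompletedAlgClosure F)) h
    simp only [Subring.coe_mul, AddSubgroupClass.coe_sub, OneMemClass.coe_one] at h2
    rw [hS, hz2, hz1]; exact h2
  have h1 : ‖z1 - 1‖ ^ (p - 1) = ‖(p : CompletedAlgClosure F)‖ := by
    have := norm_epsC_sub_one_pow (F := F) (p := p) (m := 1) le_rfl
    rwa [pow_one, Nat.totient_prime hp] at this
  have h2 : ‖z2 - 1‖ ^ (p * (p - 1)) = ‖(p : CompletedAlgClosure F)‖ := by
    have := norm_epsC_sub_one_pow (F := F) (p := p) (m := 2) (by norm_num)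
    rwa [Nat.totient_prime_pow hp (by norm_num : 0 < 2), show 2 - 1 = 1 from rfl, pow_one] at this
  have hp0 : 0 < ‖(p : CompletedAlgClosure F)‖ := norm_pos_iff.2 (natCast_C_ne_zero hp.ne_zero)
  -- `‖S‖^{p(p-1)} ‖p‖ = ‖p‖^p`
  have h3 : (‖S‖ ^ p) ^ (p - 1) = ‖(p : CompletedAlgClosure F)‖ ^ (p - 1) := by
    have h4 : (‖S‖ * ‖z2 - 1‖) ^ (p * (p - 1)) = ‖z1 - 1‖ ^ (p * (p - 1)) := by rw [← norm_mul, hgeom]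
    rw [mul_pow, h2, mul_comm p, pow_mul, pow_mul, h1, pow_right_comm] at h4
    -- `h4 : (‖S‖^p)^(p-1) * ‖p‖ = ‖p‖^p`
    have h5 : ‖(p : CompletedAlgClosure F)‖ ^ p = ‖(p : CompletedAlgClosure F)‖ ^ (p - 1) * ‖(p : CompletedAlgClosure F)‖ := by
      rw [← pow_succ, Nat.sub_add_cancel hp.one_lt.le]
    rw [h5] at h4
    exact mul_right_cancel₀ hp0.ne' h4
  exact (pow_left_inj₀ (pow_nonneg (norm_nonneg _) _) (norm_nonneg _) (Nat.sub_ne_zero_of_lt hp.one_lt)).1 h3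

/-- **`ω = ξ·c` with `θ(c) ≠ 0`**: `ω ∉ ξ²𝔸_inf`. (If `ω = ξ²c'` then modulo `p`, at level one,
`1 + ζ_{p²} + ⋯ + ζ_{p²}^{p-1} ≡ (p^{1/p})²·d (mod p)`, contradicting the norms `‖p‖^{1/p}` versus
`≤ ‖p‖^{2/p}`.) [cite: FontaineAsterisque223III, Exp. II §1.2.2] [cite: FontaineOuyang2022, Prop. 5.1.6] -/
theorem exists_omega_eq_xi_mul :
    ∃ c : Ainf (p := p) F, omega = xi * c ∧ fontaineTheta (integerC F) p c ≠ 0 := by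
  have hp := (Fact.out : p.Prime)
  -- `θ(ω) = 1 + ζ_p + ⋯ + ζ_p^{p-1} = 0`
  have hθω : fontaineTheta (integerC F) p (omega : Ainf (p := p) F) = 0 := by
    rw [omega_def, map_sum]
    simp only [map_pow, fontaineTheta_teichmuller_epsRoot]
    exact geom_sum_epsC_one
  obtain ⟨c, hc⟩ := xi_dvd_of_fontaineTheta_eq_zero hθω
  refine ⟨c, hc, fun h0 => ?_⟩
  obtain ⟨c', rfl⟩ := xi_dvd_of_fontaineTheta_eq_zero h0
  -- reduce mod `p` and take the first coefficient
  have h1' : constantCoeff (omega : Ainf (p := p) F) = pFlat * pFlat * constantCoeff c' := by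
    rw [hc, map_mul, map_mul, constantCoeff_xi, mul_assoc]
  have h1 := congrArg (PreTilt.coeff 1) h1'
  rw [coeff_one_constantCoeff_omega, map_mul, map_mul, coeff_pFlat] at h1
  obtain ⟨d, hd⟩ := Ideal.Quotient.mk_surjective (PreTilt.coeff 1 (constantCoeff c'))
  rw [← hd, ← map_mul, ← map_mul, Ideal.Quotient.eq, Ideal.mem_span_singleton'] at h1
  obtain ⟨k, hk⟩ := h1
  -- `S = r₁² d + k p` in `ℂ_F`
  set S : CompletedAlgClosure F := (((Finset.range p).sum fun i => (epsC p 2 : integerC F) ^ i : integerC F) : CompletedAlgClosure F) with hS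
  set r : CompletedAlgClosure F := ((pRootC p 1 : integerC F) : CompletedAlgClosure F) with hr
  have hSeq : S = r * r * ((d : integerC F) : CompletedAlgClosure F) + ((k : integerC F) : CompletedAlgClosure F) * (p : CompletedAlgClosure F) := by
    have h2 := congrArg (fun x : integerC F => (x : CompletedAlgClosure F)) hk
    simp only [Subring.coe_mul, AddSubgroupClass.coe_sub, coe_natCast_integerC] at h2
    rw [hS, hr]; linear_combination -h2
  have hlt : ‖(p : CompletedAlgClosure F)‖ < 1 := norm_natCast_C_lt_one'
  have hp0 : 0 < ‖(p : CompletedAlgClosure F)‖ := norm_pos_iff.2 (natCast_C_ne_zero hp.ne_zero)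
  have hSp : ‖S‖ ^ p = ‖(p : CompletedAlgClosure F)‖ := norm_geom_sum_epsC_two_pow
  have hrp : ‖r‖ ^ p = ‖(p : CompletedAlgClosure F)‖ := by
    have := norm_pRootC_pow (F := F) (p := p) 1; rwa [pow_one] at this
  -- norms of the two summands, raised to the `p`-th power, are `< ‖p‖`
  have hA : ‖r * r * ((d : integerC F) : CompletedAlgClosure F)‖ ^ p < ‖(p : CompletedAlgClosure F)‖ := by
    rw [norm_mul, norm_mul, mul_pow, mul_pow, hrp]
    calc ‖(p : CompletedAlgClosure F)‖ * ‖(p : CompletedAlgClosure F)‖ * ‖((d : integerC F) : CompletedAlgClosure F)‖ ^ p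
        ≤ ‖(p : CompletedAlgClosure F)‖ * ‖(p : CompletedAlgClosure F)‖ * 1 := by
          refine mul_le_mul_of_nonneg_left (pow_le_one₀ (norm_nonneg _) (norm_coe_integerC_le d)) ?_
          exact mul_nonneg (norm_nonneg _) (norm_nonneg _)
      _ < ‖(p : CompletedAlgClosure F)‖ := by rw [mul_one]; exact mul_lt_of_lt_one_right hp0 hlt
  have hB : ‖((k : integerC F) : CompletedAlgClosure F) * (p : CompletedAlgClosure F)‖ ^ p < ‖(p : CompletedAlgClosure F)‖ := by
    rw [norm_mul, mul_pow]
    calc ‖((k : integerC F) : CompletedAlgClosure F)‖ ^ p * ‖(p : CompletedAlgClosure F)‖ ^ p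
        ≤ 1 * ‖(p : CompletedAlgClosure F)‖ ^ p :=
          mul_le_mul_of_nonneg_right (pow_le_one₀ (norm_nonneg _) (norm_coe_integerC_le k)) (pow_nonneg (norm_nonneg _) _)
      _ < ‖(p : CompletedAlgClosure F)‖ := by
          rw [one_mul]
          exact pow_lt_self_of_lt_one₀ hp0 hlt hp.one_lt
  -- ultrametric inequality
  have hmax : ‖S‖ ≤ max ‖r * r * ((d : integerC F) : CompletedAlgClosure F)‖ ‖((k : integerC F) : CompletedAlgClosure F) * (p : CompletedAlgClosure F)‖ := by
    rw [hSeq]; exact IsUltrametricDist.norm_add_le_max _ _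
  have hmax' : ‖S‖ ^ p < ‖(p : CompletedAlgClosure F)‖ := by
    rcases le_max_iff.1 hmax with h | h
    · exact lt_of_le_of_lt (pow_le_pow_left₀ (norm_nonneg _) h p) hA
    · exact lt_of_le_of_lt (pow_le_pow_left₀ (norm_nonneg _) h p) hB
  rw [hSp] at hmax'
  exact lt_irrefl _ hmax'

/-- **`u = [ε] − 1 = ξ·c'` with `θ(c') ≠ 0`** (so `u` is a uniformizer of `B_dR⁺(F)`).
[cite: FontaineAsterisque223III, Exp. II §1.5.4] [cite: FontaineOuyang2022, Prop. 5.1.6] -/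
theorem exists_uAinf_eq_xi_mul :
    ∃ c : Ainf (p := p) F, uAinf = xi * c ∧ fontaineTheta (integerC F) p c ≠ 0 := by
  obtain ⟨c, hc, hθ⟩ := exists_omega_eq_xi_mul (F := F) (p := p)
  refine ⟨(teichmuller p (epsRoot : PreTilt (integerC F) p) - 1) * c, ?_, ?_⟩
  · rw [uAinf_eq_mul_omega, hc]; ring
  · rw [map_mul]
    exact mul_ne_zero fontaineTheta_teichmuller_epsRoot_sub_one_ne_zero hθ

end Tilt

end Literature.NumberTheory.PAdicHodge

end
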